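import Summits.QuantumFields.YangMills.Theorems.BalabanUVNodesN08AlphaAbelianLift
import Literature.MathematicalPhysics.QuantumFieldTheory.Balaban1983to89.B7Prop1Local

/-!
# Route «BalabanUVNodes», Track-A DAG node N08 = [Balaban1985UV3] — (α) clause, the in-edge sentence (b11‴) CONSTRUCTED, part 2:
# THE ITERATED AVERAGE (43) ON ABELIAN CONFIGURATIONS — curvature of the linear block average (corner cancellation + Stokes), the
# cone-local exact form of `Ū^j`, stripe curvatures under iteration, and the flux of the contours `Γ_{c,x} ∪ (−c)` as a sum of plaquette curls

Cell `pub-ymgap`, seat `pub-ymgap-dag-n08-d` gen 5, file F2 (over F1 `…N08AlphaAbelianLift`).  `bears_on: R4∕N08`; filed `--supports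
stmt-QuantumFields-19910 --as helper`.  Sorry-free, standard axioms.

CONTENTS ([folklore] lattice calculus over [4]'s definitions; the tree's `B7Prop1Explicit.corner_cancellation` ∕ `stokes` and `B7Prop1Local.bavg_congr`
BY NAME):
* §1 `curl a x μ ν = a(x,μ) + a(x+e_μ,ν) − a(x+e_ν,μ) − a(x,ν)`; ★ `curl_linAvgR`: the curl of the (rescaled) linear block average is the block mean of
  the fluxes through the translated `L × L` squares: `curl(linAvg a)(z; μ,ν) = L^{−d} Σ_{r∈[0,L)^d} Σ_{i,j<L} curl a(Lz + r + ie_μ + je_ν; μ,ν)`.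
* §2 `linAvgIter L a j` (the `j`-fold linear average, mirroring `avgIter`) and the cone-local exactness ★ `avgIter_abelCfg`: if the contour fluxes of
  the linear iterates are `< log 2 ∕ ‖X‖` on the dependency cone of a level-`j` bond (`ConeTame`), then `Ū^j(abelCfg X a) = abelCfg X (linAvgIter L a j)`
  at that bond (induction with `bavg_congr` + F1's `bavg_abelCfg`).
* §3 STRIPES: if `curl a(·; μ,ν)` depends on one of the two coordinates only, `x ↦ f(x_λ)`, then so does every iterate, through the TENT sums
  `tent M f w = Σ_{t,u<M} f(Mw + t + u)`: ★ `curl_linAvgIter_of_stripes`: `curl(linAvgIter L a j)(z; μ,ν) = tent (L^j) f (z_λ)`.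
* §4 the flux `wflux` of `Γ_{c,x} ∪ (−c)` as a double sum of plaquette curls over the ladder it sweeps (`wflux_boxVec_eq_sum_curl`) and the bound
  `|wflux| ≤ d·L²·(max |curl| on B(c₋) ∪ B(c₊))` (`abs_wflux_le`).
HONEST FRAMING: kernel bookkeeping for TEST configurations; nothing of [B10] ∕ [7] ∕ [4]'s estimates asserted; count-neutral; NOT a discharge of N08.
d = 3 lattice gauge theory on finite tori as printed (here `d` is a parameter); nothing about d = 4, the continuum, OS axioms, a mass gap or Clay.
-/

noncomputable section

namespace Summit.QuantumFields.YangMills.Theorems.BalabanUVNodesN08AlphaAbelianAverage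

open scoped BigOperators
open NormedSpace
open Literature.MathematicalPhysics.QuantumFieldTheory.Balaban1983to89
open B7Prop1Explicit
open B7Prop1Local (InBox AgreeOn bondHi bavg_congr)
open B7Prop2Explicit (avgIter rescale rescale_apply avgIter_succ avgIter_zero)
open Summit.QuantumFields.YangMills.Theorems.BalabanUVNodesN08AlphaAbelianLift

variable {d : ℕ} (L : ℕ)

/-! ## §1 The lattice curl and the curvature of the linear block average -/

/-- **THE LATTICE CURL** of a real one-form: `curl a(x; μ,ν) = a(x,μ) + a(x+e_μ,ν) − a(x+e_ν,μ) − a(x,ν)` (= `asum a x (plaqWord μ ν)`).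
[cite: Balaban1985Averaging, (9) p.19 + (48) p.25] -/
def curl (a : Site d → Fin d → ℝ) (x : Site d) (μ ν : Fin d) : ℝ := a x μ + a (x + e μ) ν - a (x + e ν) μ - a x ν

/-- `curl = A(∂p)`. [cite: Balaban1985Averaging, (48) p.25] -/
theorem asum_plaqWord_eq_curl (a : Site d → Fin d → ℝ) (x : Site d) (μ ν : Fin d) : asum a x (plaqWord μ ν) = curl a x μ ν := by
  rw [asum_plaqWord]; rfl

/-- `curl a x μ μ = 0`. [folklore] -/
theorem curl_self (a : Site d → Fin d → ℝ) (x : Site d) (μ : Fin d) : curl a x μ μ = 0 := by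
  unfold curl; ring

/-- `curl a x ν μ = − curl a x μ ν`. [folklore] -/
theorem curl_swap (a : Site d → Fin d → ℝ) (x : Site d) (μ ν : Fin d) : curl a x ν μ = -curl a x μ ν := by
  unfold curl; ring

/-- **★ THE CURVATURE OF THE LINEAR BLOCK AVERAGE** (corner cancellation (48) + the abelian Stokes formula): for the rescaled average
`ā = rescale L (linAvg L a)` on the unit lattice, `curl ā(z; μ,ν) = L^{−d} Σ_{r∈[0,L)^d} Σ_{i<L} Σ_{j<L} curl a(Lz + r + ie_μ + je_ν; μ,ν)`.
[cite: Balaban1985Averaging, (48) p.25] -/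
theorem curl_linAvgR (a : Site d → Fin d → ℝ) (z : Site d) (μ ν : Fin d) :
    curl (rescale L (linAvg L a)) z μ ν = ((L : ℝ) ^ d)⁻¹ * ∑ r : Fin d → Fin L, ∑ i ∈ Finset.range L, ∑ j ∈ Finset.range L,
      curl a ((L : ℤ) • z + boxVec L r + (i : ℤ) • e μ + (j : ℤ) • e ν) μ ν := by
  simp only [curl, rescale_apply, linAvg, smul_add]
  rw [← mul_add, ← mul_sub, ← mul_sub]
  congr 1
  rw [← Finset.sum_add_distrib, ← Finset.sum_sub_distrib, ← Finset.sum_sub_distrib]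
  refine Finset.sum_congr rfl fun r _ => ?_
  rw [corner_cancellation, stokes]
  simp only [asum_plaqWord]

/-! ## §2 The iterated linear average and the cone-local exact form of `Ū^j` -/

/-- **THE `j`-FOLD LINEAR AVERAGE** (mirroring `B7Prop2Explicit.avgIter`: `0 ↦ a`, `j+1 ↦ rescale L (linAvg L ·)`). [cite: Balaban1985Averaging, (43) p.24] -/
def linAvgIter (a : Site d → Fin d → ℝ) : ℕ → Site d → Fin d → ℝ
  | 0 => a
  | j + 1 => rescale L (linAvg L (linAvgIter a j))

/-- `linAvgIter a 0 = a`. [folklore] -/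
@[simp] theorem linAvgIter_zero (a : Site d → Fin d → ℝ) : linAvgIter L a 0 = a := rfl

/-- `linAvgIter a (j+1) = rescale L (linAvg L (linAvgIter a j))`. [folklore] -/
theorem linAvgIter_succ (a : Site d → Fin d → ℝ) (j : ℕ) : linAvgIter L a (j + 1) = rescale L (linAvg L (linAvgIter L a j)) := rfl

variable {𝔸 : Type*} [NormedRing 𝔸] [NormedAlgebra ℂ 𝔸] [CompleteSpace 𝔸]

/-- Rescaling commutes with `abelCfg`. [folklore] -/
theorem abelCfg_rescale (X : 𝔸) (b : Site d → Fin d → ℝ) : abelCfg X (rescale L b) = rescale L (abelCfg X b) := rfl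

/-- **SMALL CONTOUR FLUXES AT A BOND**: every `|Φ(Γ_{c,x} ∪ −c)|·‖X‖ < log 2` at the `L`-bond `c = ⟨q, q + Le_κ⟩` (the hypothesis of F1's `bavg_abelCfg`).
[cite: Balaban1985Averaging, (42) p.23] -/
def SmallFlux (X : 𝔸) (b : Site d → Fin d → ℝ) (q : Site d) (κ : Fin d) : Prop :=
  ∀ r : Fin d → Fin L, |wflux L b q κ (boxVec L r)| * ‖X‖ < Real.log 2

/-- **THE DEPENDENCY CONE OF A LEVEL-`j` BOND IS TAME**: the fluxes of the level-`(j−1)` linear iterate at the `L`-bond below `(z, κ)` are small, and,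
recursively, every level-`(j−1)` bond with both endpoints in `B(c₋) ∪ B(c₊)` (the bonds `Ū^j_c` reads, [4] p. 24) has a tame cone. [cite: Balaban1985Averaging, p.24 (locality after (43))] -/
def ConeTame (X : 𝔸) (a : Site d → Fin d → ℝ) : ℕ → Site d → Fin d → Prop
  | 0, _, _ => True
  | j + 1, z, κ => SmallFlux L X (linAvgIter L a j) ((L : ℤ) • z) κ ∧
      ∀ (y : Site d) (μ : Fin d), InBox ((L : ℤ) • z) (bondHi L ((L : ℤ) • z) κ) y → InBox ((L : ℤ) • z) (bondHi L ((L : ℤ) • z) κ) (y + e μ) →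
        ConeTame X a j y μ

/-- **★ THE `j`-FOLD AVERAGE (43) OF AN ABELIAN CONFIGURATION IS THE ABELIAN CONFIGURATION OF ITS `j`-FOLD LINEAR AVERAGE, AT EVERY BOND WITH A TAME
CONE** (induction on `j`: locality `bavg_congr` of [4] p. 24 + F1's one-step exactness). [cite: Balaban1985Averaging, (43) p.24] -/
theorem avgIter_abelCfg (hL : 1 ≤ L) (X : 𝔸) (a : Site d → Fin d → ℝ) :
    ∀ (j : ℕ) (z : Site d) (κ : Fin d), ConeTame L X a j z κ → avgIter L (abelCfg X a) j z κ = abelCfg X (linAvgIter L a j) z κ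
  | 0, _, _, _ => rfl
  | j + 1, z, κ, h => by
    rw [avgIter_succ, rescale_apply, linAvgIter_succ, abelCfg_rescale, rescale_apply]
    have hagree : AgreeOn ((L : ℤ) • z) (bondHi L ((L : ℤ) • z) κ) (avgIter L (abelCfg X a) j) (abelCfg X (linAvgIter L a j)) :=
      fun y μ hy hye => avgIter_abelCfg hL X a j y μ (h.2 y μ hy hye)
    rw [bavg_congr L hL _ κ hagree]
    exact bavg_abelCfg L (by omega) X _ _ κ h.1

/-! ## §3 Stripes: curvatures depending on one coordinate, and their tent sums under iteration -/

/-- **THE TENT SUM** `tent M f w = Σ_{t<M} Σ_{u<M} f(Mw + t + u)` (the `M`-window double sum = the tent-weighted sum over `[Mw, Mw + 2M − 2]`).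
[folklore] -/
def tent (M : ℕ) (f : ℤ → ℝ) (w : ℤ) : ℝ := ∑ t : Fin M, ∑ u : Fin M, f ((M : ℤ) * w + (t : ℕ) + (u : ℕ))

/-- `tent 1 f = f`. [folklore] -/
theorem tent_one (f : ℤ → ℝ) : tent 1 f = f := by
  funext w; simp [tent]

/-- The value of `finProdFinEquiv (t, t')` is `M·t + t'`. [folklore] -/
theorem val_finProdFinEquiv (M K : ℕ) (p : Fin K × Fin M) : ((finProdFinEquiv p : Fin (K * M)) : ℕ) = M * p.1 + p.2 := by
  simp [finProdFinEquiv, Nat.add_comm]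

/-- **Tents compose**: `tent K (tent M f) = tent (K·M) f`. [folklore] -/
theorem tent_tent (M K : ℕ) (f : ℤ → ℝ) : tent K (tent M f) = tent (K * M) f := by
  funext w
  simp only [tent]
  symm
  rw [← Fintype.sum_prod_type', ← ((finProdFinEquiv (m := K) (n := M)).prodCongr (finProdFinEquiv (m := K) (n := M))).sum_comp]
  simp only [Equiv.prodCongr_apply, Fintype.sum_prod_type, Prod.map_apply, val_finProdFinEquiv]
  refine Fintype.sum_congr _ _ fun t => ?_
  rw [Finset.sum_comm]
  refine Fintype.sum_congr _ _ fun u => Fintype.sum_congr _ _ fun t' => Fintype.sum_congr _ _ fun u' => ?_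
  congr 1; push_cast; ring

/-- Sums over the box `[0,L)^d` of a function of ONE coordinate. [folklore] -/
theorem sum_box_apply (ν : Fin d) (g : Fin L → ℝ) :
    ∑ r : Fin d → Fin L, g (r ν) = ((L : ℝ) ^ (d - 1)) * ∑ t : Fin L, g t := by
  rw [← (Equiv.funSplitAt ν (Fin L)).symm.sum_comp, Fintype.sum_prod_type]
  simp only [Equiv.funSplitAt, Equiv.piSplitAt_symm_apply, dif_pos]
  rw [Finset.mul_sum]
  refine Finset.sum_congr rfl fun t _ => ?_
  rw [Finset.sum_const, Finset.card_univ, nsmul_eq_mul, Fintype.card_fun, Fintype.card_fin,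
    Fintype.card_subtype_compl, Fintype.card_fin, Fintype.card_subtype_eq]
  push_cast; ring

/-- Box sums of a function of one coordinate plus a window offset: `Σ_{r∈[0,L)^d} Σ_{k<L} g(c + r_λ + k) = L^{d−1}·Σ_{t,u<L} g(c + t + u)`. [folklore] -/
theorem sum_box_range (lam : Fin d) (g : ℤ → ℝ) (c : ℤ) :
    ∑ r : Fin d → Fin L, ∑ k ∈ Finset.range L, g (c + ((r lam : ℕ) : ℤ) + (k : ℤ)) =
      ((L : ℝ) ^ (d - 1)) * ∑ t : Fin L, ∑ u : Fin L, g (c + ((t : ℕ) : ℤ) + ((u : ℕ) : ℤ)) := by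
  rw [← sum_box_apply L lam (fun t : Fin L => ∑ u : Fin L, g (c + ((t : ℕ) : ℤ) + ((u : ℕ) : ℤ)))]
  refine Finset.sum_congr rfl fun r _ => ?_
  rw [Finset.sum_range]

/-- The `λ`-coordinate of `Lz + r + ie_μ + je_ν`. [folklore] -/
theorem coord_eq (z : Site d) (r : Fin d → Fin L) (i j : ℕ) (μ ν lam : Fin d) :
    ((L : ℤ) • z + boxVec L r + (i : ℤ) • e μ + (j : ℤ) • e ν) lam =
      (L : ℤ) * z lam + ((r lam : ℕ) : ℤ) + ((if lam = μ then (i : ℤ) else 0) + (if lam = ν then (j : ℤ) else 0)) := by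
  simp only [Pi.add_apply, Pi.smul_apply, smul_eq_mul, e_apply, boxVec, mul_ite, mul_one, mul_zero]
  ring

/-- **ONE STEP ON STRIPES**: if `curl a(x; μ,ν) = f(x_λ)` for all `x`, with `λ ∈ {μ, ν}`, `μ ≠ ν`, then `curl(rescale L (linAvg L a))(z; μ,ν) =
tent L f (z_λ)`. [folklore] -/
theorem curl_linAvgR_of_stripes (hL : 1 ≤ L) (hd : 1 ≤ d) {a : Site d → Fin d → ℝ} {μ ν lam : Fin d} (hμν : μ ≠ ν)
    (hlam : lam = μ ∨ lam = ν) {f : ℤ → ℝ} (hf : ∀ x, curl a x μ ν = f (x lam)) (z : Site d) :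
    curl (rescale L (linAvg L a)) z μ ν = tent L f (z lam) := by
  have hL0 : (L : ℝ) ≠ 0 := by exact_mod_cast (show L ≠ 0 by omega)
  have hpow : ((L : ℝ) ^ d)⁻¹ * (L : ℝ) * ((L : ℝ) ^ (d - 1)) = 1 := by
    rw [mul_assoc, ← pow_succ', Nat.sub_add_cancel hd, inv_mul_cancel₀ (pow_ne_zero _ hL0)]
  rw [curl_linAvgR]
  simp only [hf, coord_eq]
  -- reduce the triple sum to `L · Σ_r Σ_k f(c + r_λ + k)`
  have hred : ∑ r : Fin d → Fin L, ∑ i ∈ Finset.range L, ∑ j ∈ Finset.range L,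
      f ((L : ℤ) * z lam + ((r lam : ℕ) : ℤ) + ((if lam = μ then (i : ℤ) else 0) + (if lam = ν then (j : ℤ) else 0))) =
      (L : ℝ) * ∑ r : Fin d → Fin L, ∑ k ∈ Finset.range L, f ((L : ℤ) * z lam + ((r lam : ℕ) : ℤ) + (k : ℤ)) := by
    rw [Finset.mul_sum]
    refine Finset.sum_congr rfl fun r _ => ?_
    rcases hlam with rfl | rfl
    · simp only [if_true, if_neg hμν, add_zero, Finset.sum_const, Finset.card_range, nsmul_eq_mul, Finset.mul_sum]
    · simp only [if_true, if_neg (Ne.symm hμν), zero_add, Finset.sum_const, Finset.card_range, nsmul_eq_mul, Finset.mul_sum]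
  rw [hred, sum_box_range, ← mul_assoc, ← mul_assoc, hpow, one_mul]
  rfl

/-- **★ STRIPES UNDER ITERATION**: if `curl a(x; μ,ν) = f(x_λ)` (`λ ∈ {μ,ν}`, `μ ≠ ν`), then `curl(linAvgIter L a j)(z; μ,ν) = tent (L^j) f (z_λ)` for
every `j`. [folklore] -/
theorem curl_linAvgIter_of_stripes (hL : 1 ≤ L) (hd : 1 ≤ d) {a : Site d → Fin d → ℝ} {μ ν lam : Fin d} (hμν : μ ≠ ν)
    (hlam : lam = μ ∨ lam = ν) {f : ℤ → ℝ} (hf : ∀ x, curl a x μ ν = f (x lam)) :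
    ∀ (j : ℕ) (z : Site d), curl (linAvgIter L a j) z μ ν = tent (L ^ j) f (z lam)
  | 0, z => by rw [linAvgIter_zero, pow_zero, tent_one, hf]
  | j + 1, z => by
    rw [linAvgIter_succ, curl_linAvgR_of_stripes L hL hd hμν hlam (curl_linAvgIter_of_stripes hL hd hμν hlam hf j) z, tent_tent,
      pow_succ']

/-! ## §4 The flux of `Γ_{c,x} ∪ (−c)` as a sum of plaquette curls, and its bound -/

/-- Positive letters. [folklore] -/
def posL (ν : Fin d) : Letter d := (ν, true)

/-- The abelian flux of the one-rung-wide ladder `w ∪ [x, x+e_κ] ∪ (−w)′ ∪ [−e_κ]` telescoped along the word: `A_p(w) − A_{p+e_κ}(w) + a(p + disp w, κ)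
− a(p, κ) = Σ_m curl a(p + disp(w↾m); ν_m, κ)` for a word of positive letters. [cite: Balaban1985Averaging, (47)–(48) p.25] -/
theorem ladderFlux_eq_sum_curl (a : Site d → Fin d → ℝ) (κ : Fin d) :
    ∀ (w : List (Fin d)) (p : Site d),
      asum a p (w.map posL) - asum a (p + e κ) (w.map posL) + a (p + disp (w.map posL)) κ - a p κ =
      ∑ m ∈ Finset.range w.length, curl a (p + disp ((w.take m).map posL)) (w.getD m κ) κ
  | [], p => by simp
  | ν :: w, p => by
    rw [List.map_cons, asum_cons, asum_cons, List.length_cons, Finset.sum_range_succ']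
    simp only [posL, disp_cons, stepA_true, Letter.vec_true, List.take_succ_cons, List.map_cons, List.getD_cons_succ, List.take_zero,
      List.map_nil, disp_nil, add_zero, List.getD_cons_zero, ← add_assoc]
    have ih := ladderFlux_eq_sum_curl a κ w (p + e ν)
    rw [show p + e κ + e ν = p + e ν + e κ by abel, ← ih]
    unfold curl; ring

/-- The tree word of a non-negative vector is a word of positive letters: `treeWord (boxVec r) = (dirs r).map (·, true)` with `dirs r` the list of
its directions (length `l1 (boxVec r)`). [folklore] -/
theorem treeWord_boxVec_eq_map (r : Fin d → Fin L) :
    ∃ dirs : List (Fin d), treeWord (boxVec L r) = dirs.map posL ∧ dirs.length = l1 (boxVec L r) := by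
  refine ⟨(treeWord (boxVec L r)).map Prod.fst, ?_, ?_⟩
  · rw [List.map_map]
    conv_lhs => rw [← List.map_id (treeWord (boxVec L r))]
    refine List.map_congr_left fun l hl => ?_
    obtain ⟨μ, b⟩ := l
    have hb : b = true := by
      simp only [treeWord, List.mem_flatMap, List.mem_reverse, List.mem_finRange, true_and] at hl
      obtain ⟨κ', hκ'⟩ := hl
      rw [show boxVec L r κ' = ((r κ' : ℕ) : ℤ) from rfl, seg_natCast, List.mem_replicate] at hκ'
      exact (Prod.mk.inj hκ'.2).2
    subst hb; rfl
  · rw [List.length_map, length_treeWord]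

/-- **THE FLUX OF `Γ_{c,x} ∪ (−c)` TELESCOPED INTO `L` LADDERS**: `wflux L a q κ r = Σ_{s<L} [A_{q+se_κ}(Γ) − A_{q+(s+1)e_κ}(Γ) + a(q+r+se_κ, κ) −
a(q+se_κ, κ)]`, `Γ = treeWord r`. [cite: Balaban1985Averaging, (42) p.23 + (14) p.19] -/
theorem wflux_eq_sum_ladder (a : Site d → Fin d → ℝ) (q : Site d) (κ : Fin d) (r : Site d) :
    wflux L a q κ r = ∑ s ∈ Finset.range L, (asum a (q + (s : ℤ) • e κ) (treeWord r) - asum a (q + ((s : ℤ) + 1) • e κ) (treeWord r)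
      + a (q + r + (s : ℤ) • e κ) κ - a (q + (s : ℤ) • e κ) κ) := by
  rw [wflux, asum_gammaWord, asum_seg_natCast, asum_seg_natCast]
  have htel := Finset.sum_range_sub' (fun s : ℕ => asum a (q + (s : ℤ) • e κ) (treeWord r)) L
  simp only [Nat.cast_zero, zero_smul, add_zero, Nat.cast_succ] at htel
  rw [Finset.sum_sub_distrib, Finset.sum_add_distrib, htel]
  ring

/-- **★ THE CONTOUR FLUX IS BOUNDED BY THE PLAQUETTE CURLS OF THE BOX**: if every plaquette `(x; ν, κ)` with `x, x + e_ν + e_κ ∈ [q, bondHi L q κ]` has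
`|curl a| ≤ m`, then `|wflux L a q κ (boxVec r)| ≤ d·L²·m` (the contour sweeps `L·|r|₁ ≤ L·d(L−1)` plaquettes of the box). [cite: Balaban1985Averaging, (47)–(49) p.25] -/
theorem abs_wflux_le (hL : 1 ≤ L) (a : Site d → Fin d → ℝ) (q : Site d) (κ : Fin d) (r : Fin d → Fin L) {m : ℝ} (hm : 0 ≤ m)
    (hcurl : ∀ (x : Site d) (ν : Fin d), InBox q (bondHi L q κ) x → InBox q (bondHi L q κ) (x + e ν + e κ) → |curl a x ν κ| ≤ m) :
    |wflux L a q κ (boxVec L r)| ≤ d * (L : ℝ) ^ 2 * m := by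
  obtain ⟨dirs, hdirs, hlen⟩ := treeWord_boxVec_eq_map L r
  rw [wflux_eq_sum_ladder]
  -- each ladder is a sum of `l1 r` curls of box plaquettes
  have hlad : ∀ s ∈ Finset.range L, |asum a (q + (s : ℤ) • e κ) (treeWord (boxVec L r)) - asum a (q + ((s : ℤ) + 1) • e κ) (treeWord (boxVec L r))
      + a (q + boxVec L r + (s : ℤ) • e κ) κ - a (q + (s : ℤ) • e κ) κ| ≤ (l1 (boxVec L r)) * m := by
    intro s hs
    rw [Finset.mem_range] at hs
    have hdisp : disp (dirs.map posL) = boxVec L r := by rw [← hdirs, disp_treeWord]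
    have key := ladderFlux_eq_sum_curl a κ dirs (q + (s : ℤ) • e κ)
    rw [hdisp, show q + (s : ℤ) • e κ + e κ = q + ((s : ℤ) + 1) • e κ by rw [add_smul, one_smul, add_assoc],
      show q + (s : ℤ) • e κ + boxVec L r = q + boxVec L r + (s : ℤ) • e κ by abel, ← hdirs] at key
    rw [key, ← hlen]
    refine (Finset.abs_sum_le_sum_abs _ _).trans ?_
    have hnn : ∀ (l : List (Fin d)) (i : Fin d), 0 ≤ disp (l.map posL) i := by
      intro l i
      induction l with
      | nil => simp [disp_nil]
      | cons ν l ih => simp only [List.map_cons, posL, disp_cons, Letter.vec_true, Pi.add_apply, e_apply]; split_ifs <;> linarith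
    have hcount : ∀ m' ∈ Finset.range dirs.length, |curl a (q + (s : ℤ) • e κ + disp ((dirs.take m').map posL)) (dirs.getD m' κ) κ| ≤ m := by
      intro m' hm'
      rw [Finset.mem_range] at hm'
      -- the prefix displacement is dominated by `boxVec r` coordinatewise
      have hpre : ∀ i, 0 ≤ disp ((dirs.take m').map posL) i ∧
          disp ((dirs.take m').map posL) i + (if i = dirs.getD m' κ then 1 else 0) ≤ boxVec L r i := by
        intro i
        have hsplit : dirs = dirs.take m' ++ dirs.drop m' := (List.take_append_drop m' dirs).symm
        have hdispall : disp (dirs.map posL) i = boxVec L r i := by rw [hdisp]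
        rw [hsplit, List.map_append, disp_append, Pi.add_apply] at hdispall
        refine ⟨hnn _ i, ?_⟩
        have hdrop : (if i = dirs.getD m' κ then (1 : ℤ) else 0) ≤ disp ((dirs.drop m').map posL) i := by
          rw [List.drop_eq_getElem_cons hm', List.map_cons, posL, disp_cons, Letter.vec_true, Pi.add_apply, e_apply,
            List.getD_eq_getElem _ _ hm']
          have := hnn (dirs.drop (m' + 1)) i
          split_ifs <;> linarith
        linarith
      refine hcurl _ _ (fun i => ?_) (fun i => ?_)
      · have h1 := (hpre i).1
        have h2 := (hpre i).2
        have h3 := (r i).isLt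
        simp only [bondHi, Pi.add_apply, Pi.smul_apply, smul_eq_mul, e_apply, boxVec] at h1 h2 ⊢
        split_ifs at h2 ⊢ <;> constructor <;> nlinarith
      · have h1 := (hpre i).1
        have h2 := (hpre i).2
        have h3 := (r i).isLt
        simp only [bondHi, Pi.add_apply, Pi.smul_apply, smul_eq_mul, e_apply, boxVec] at h1 h2 ⊢
        split_ifs at h2 ⊢ <;> constructor <;> nlinarith
    refine (Finset.sum_le_sum hcount).trans ?_
    rw [Finset.sum_const, Finset.card_range, nsmul_eq_mul]
  refine (Finset.abs_sum_le_sum_abs _ _).trans ?_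
  refine (Finset.sum_le_sum hlad).trans ?_
  rw [Finset.sum_const, Finset.card_range, nsmul_eq_mul]
  have hl1 : (l1 (boxVec L r) : ℝ) ≤ d * L := by exact_mod_cast l1_boxVec_le L r
  have hL' : (0 : ℝ) ≤ L := Nat.cast_nonneg L
  calc (L : ℝ) * ((l1 (boxVec L r) : ℝ) * m) ≤ (L : ℝ) * ((d * L) * m) := by gcongr
    _ = d * (L : ℝ) ^ 2 * m := by ring

end Summit.QuantumFields.YangMills.Theorems.BalabanUVNodesN08AlphaAbelianAverage

end
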